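import Summits.BirchSwinnertonDyer.BirchSwinnertonDyer.Theorems.ByReductionTypeAtTwoOrdHalvesDefs
import Summits.BirchSwinnertonDyer.BirchSwinnertonDyer.Theorems.ByReductionTypeAtTwoLambdaConstPinch
import Summits.BirchSwinnertonDyer.Rank1Residual.X5.TwoAdicMuZeroUpgrade
import Summits.BirchSwinnertonDyer.Rank1Residual.X5.TwoAdicTargetsAlphaAuto
import Summits.BirchSwinnertonDyer.Rank1Residual.X5.TwoAdicTargetsEisenstein
import Summits.BirchSwinnertonDyer.Rank1Residual.X1.LambdaSqueezeAlgebra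
import Summits.BirchSwinnertonDyer.Rank1Residual.Iwasawa.RankGrowthLayer
import Literature.NumberTheory.EllipticCurves.Greenberg1999.MordellWeilRankLayerBoundProofs
import Literature.NumberTheory.EllipticCurves.KatoDivisibilityAllPrimes
import HarnessLib

/-!
# The EISENSTEIN half of the `2`-adic main conjecture is the pair of LOWER bounds
# `λ(X) ≥ λ_an`, `μ(X) ≥ μ_an` — and holds wherever `λ_an` is Mordell–Weil growth in the `2`-tower
# (route ByReductionTypeAtTwo / TwoAdicConverse, crux `OrdEisensteinHalfAtTwo`,
# item stmt-BirchSwinnertonDyer-19151; seat bsd-2adic-ord-3)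

WHAT. The crux `OrdEisensteinHalfAtTwo` (`Theorems.OrdHalvesAtTwo.OrdEisensteinHalfAtTwo`, the children
text of the split of `GoodOrdinaryRankZeroAtTwo`) asks, for every non-CM `E/ℚ` good ordinary at `2`, the
Skinner–Urban direction `char_Λ X(E/ℚ_∞) ⊆ (ϖ·L₂(E))` of the cyclotomic main conjecture at `2`
(`X5.O1.MainConjectureEisensteinDivisibilityAtTwo W`: `ι f_X = ι h · ϖ·L₂(f,α)`, `h ∈ Λ = ℤ₂⟦T⟧`). Nothing
is printed at `p = 2`. This file does NOT prove it class-wide. It proves, with no new named fact: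

* §1 (pure `Λ`-algebra, any `p`). From a RATIONAL divisibility `A·g = B·L` with `λ(B) = 0` (the shape
  of Kato's Thm. 17.4 (2) pulled back to `Λ`: `(num ϖ · a)·f_X = 2ⁿ·(den ϖ · L₀)`,
  `X5.O1.MuZeroUpgrade.exists_mul_charGen_eq_of_kato_allPrimes`), the divisibility `L ∣ g` in `Λ` is
  EQUIVALENT to the two inequalities `λ(L) ≤ λ(g) ∧ μ(L) ≤ μ(g)`, and then
  `g = p^{μ(g)−μ(L)}·u·L` with `u ∈ Λˣ` (`exists_unit_eq_C_pow_mul_mul`, `dvd_iff_lam_le_and_mu_le`).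
* §2 (`p = 2`, any non-CM or CM `W` good ordinary at `2`). Granted Kato 17.4 (1)(2) AT `2` (`h17`, the
  PUBLISHED input already displayed by the sibling support item `OrdPublishedInputsAtTwo`) and an
  integral Néron normalisation `ι L₀ = ϖ·L₂(f,α)` (automatic from `0 ≤ ord₂ ϖ`, tree theorem
  `X5.O1.exists_integral_mul_padicLFunction_two_of_padicValRat_nonneg`): the Eisenstein half at a
  cyclotomic datum holds IFF `λ(L₀) ≤ λ(X)` and `μ(L₀) ≤ μ(X)`
  (`eisensteinAtDatum_iff_lam_le_and_mu_le`), and then `char_Λ X = (2^{μ(X)−μ(L₀)}·L₀)`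
  (`charIdeal_eq_span_C_pow_mul`); so on such a datum the main conjecture is EXACTLY `μ(X) ≤ μ(L₀)`,
  i.e. the Kato–Néron half (sibling crux `OrdKatoHalfAtTwo`). Certificate form:
  `AnalyticLambdaEq W 2 n` + `AnalyticMuLE W 2 m` + (`n ≤ λ(X)` and `m ≤ μ(X)` at every cyclotomic datum)
  ⇒ `X5.O1.MainConjectureEisensteinDivisibilityAtTwo W`
  (`mainConjectureEisensteinDivisibilityAtTwo_of_le_lambda_of_le_mu`). In words: at `2` the Eisenstein
  half is the EXHIBIT-type direction («`X(E/ℚ_∞)` is at least as big as `L₂(E)` predicts»), the Kato half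
  the EXHAUST-type direction.
* §3 The one printed source of lower bounds on `λ(X)`: Greenberg, LNM 1716, Thm. 1.9 —
  `rank_ℤ E(ℚ_k) ≤ λ(X)` at every layer of the `ℤ₂`-tower (tree THEOREM
  `WeierstrassCurve.mordellWeilRank_layer_le_lambdaInvariant`, unconditional). Hence the Eisenstein half
  at every good-ordinary-at-`2` curve with `μ_an = 0` whose analytic `λ`-invariant is Mordell–Weil growth,
  `λ(ϖ·L₂(E)) ≤ rank_ℤ E(ℚ_k)` for some `k` (typed certificate `Iwasawa.LayerRankGEAt W 2 k n`;
  `ℚ_1 = ℚ(√2)`, so `k = 1` reads `λ_an(E) ≤ rank E(ℚ) + rank E^{(2)}(ℚ)`):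
  `mainConjectureEisensteinDivisibilityAtTwo_of_layerRankGEAt`, and the ∀-closed form concluding the
  crux constant `ordEisensteinHalfAtTwo_of_layerRankGEAt_certificates`.

HONEST SCOPE. The certificate `λ_an(E) = Mordell–Weil growth` FAILS for most census classes: at a
good ordinary `2` the constant term `(1 − α⁻¹)²·L(E,1)/Ω_E` of `L₂(E)` is never a unit when `E(ℚ)[2] = 0`,
the resulting zeros of `L₂(E,T)` pair off under the functional equation `u ↦ u⁻¹` and generically sit at
NO character point `T ∈ {0, −2}` (`λ_an ≥ 2` on all 528 open good-ordinary X5 classes, TWIST-MT2 census)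
— such zeros are invisible in every finite layer, so no finite-layer certificate reaches `λ(X) ≥ λ_an`
there; that is the typed residue of this crux off the rank-growth locus. Nothing is asserted; no
`sorry`; axioms standard; O1 stays OPEN; no mark moves.

References: K. Kato, Astérisque 295 (2004), Thm. 17.4 (1)(2) (p. 273); R. Greenberg, LNM 1716 (1999),
Thm. 1.9 (p. 63), Thm. 4.1; R. Greenberg, V. Vatsal, Invent. Math. 142 (2000), p. 4; C. Skinner,
E. Urban, Invent. Math. 195 (2014), Conj. 3.6.8 / Thm. 3.6.9 (p odd); L. Washington, GTM 83, §7.1,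
§13.2.
-/

set_option autoImplicit false

noncomputable section

open scoped Classical MatrixGroups ModularForm

open CongruenceSubgroup WeierstrassCurve Literature.NumberTheory.EllipticCurves
  Literature.NumberTheory.EllipticCurves.ModularForms Literature.NumberTheory.EllipticCurves.Rank1Residual
  Literature.NumberTheory.EllipticCurves.Rank1Residual.Typed
  Summit.BirchSwinnertonDyer.Rank1Residual.X1.MuLambda
  Summit.BirchSwinnertonDyer.Rank1Residual.X1.MuPart
  Summit.BirchSwinnertonDyer.Rank1Residual.X1.ParitySqueeze

namespace Summit.BirchSwinnertonDyer.BirchSwinnertonDyer.Theorems.EisensteinLowerBounds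

/-! ## §1 Pure `Λ`-algebra: `L ∣ g` from a rational divisibility is the pair of inequalities on `λ`, `μ` -/

section Algebra

variable {p : ℕ} [Fact p.Prime]

/-- For `g ≠ 0`: the `p`-free part has `μ = 0` and is its own `p`-free part. [folklore] -/
theorem mu_pfree_eq_zero_and_pfree_pfree {g : IwasawaAlgebra p} (hg : g ≠ 0) :
    mu (pfree g) = 0 ∧ pfree (pfree g) = pfree g :=
  mu_eq_and_pfree_eq (red_pfree_ne_zero hg) (by rw [pow_zero, map_one, one_mul])

/-- `λ(pfree g) = λ(g)` for `g ≠ 0` (`λ` only sees the `p`-free part). [folklore] -/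
theorem lam_pfree {g : IwasawaAlgebra p} (hg : g ≠ 0) : lam (pfree g) = lam g := by
  rw [lam, lam, (mu_pfree_eq_zero_and_pfree_pfree hg).2]

/-- **A nonzero `g ∈ Λ` with `λ(g) = 0` is `p^{μ(g)}` times a unit** (Weierstrass preparation with a
constant distinguished polynomial). [cite: Washington1997, §7.1 (Weierstrass preparation)] -/
theorem exists_unit_eq_C_pow_mu_mul {g : IwasawaAlgebra p} (hg : g ≠ 0) (hlam : lam g = 0) :
    ∃ u : (IwasawaAlgebra p)ˣ, g = PowerSeries.C ((p : ℤ_[p]) ^ mu g) * u := by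
  have hu : IsUnit (pfree g) := by
    rw [isUnit_iff_mu_eq_zero_and_lam_eq_zero]
    exact ⟨pfree_ne_zero hg, (mu_pfree_eq_zero_and_pfree_pfree hg).1, by rw [lam_pfree hg, hlam]⟩
  exact ⟨hu.unit, by rw [IsUnit.unit_spec]; exact eq_C_pow_mu_mul_pfree g⟩

/-- The trivial direction: if `g = h·L ≠ 0` then `λ(L) ≤ λ(g)` and `μ(L) ≤ μ(g)`. [folklore] -/
theorem lam_le_and_mu_le_of_eq_mul {g L h : IwasawaAlgebra p} (hg : g ≠ 0) (he : g = h * L) :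
    lam L ≤ lam g ∧ mu L ≤ mu g := by
  have hh : h ≠ 0 := by rintro rfl; exact hg (by rw [he, zero_mul])
  have hL : L ≠ 0 := by rintro rfl; exact hg (by rw [he, mul_zero])
  rw [he, mul_comm]
  exact ⟨lam_le_lam_mul hL hh, mu_le_mu_mul hL hh⟩

/-- **The Eisenstein pinch (pure algebra).** Let `g, L ∈ Λ = ℤ_p⟦T⟧` be nonzero with a RATIONAL
divisibility `A·g = B·L`, `B ≠ 0`, `λ(B) = 0` (e.g. `B` a nonzero constant `pⁿ·d`). If `λ(L) ≤ λ(g)` and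
`μ(L) ≤ μ(g)` then `g = p^{μ(g)−μ(L)}·u·L` for a unit `u` — in particular `L ∣ g` in `Λ`. Proof: `λ` is
additive, so `λ(A) = 0` and `A = p^{μ(A)}·u_A`, `B = p^{μ(B)}·u_B` (`exists_unit_eq_C_pow_mu_mul`); `μ`
is additive, so `μ(B) − μ(A) = μ(g) − μ(L) ≥ 0`; cancel `p^{μ(A)}` in the domain `Λ`.
[cite: GreenbergVatsal2000, p. 4 (after Thm. (1.2))] [cite: Washington1997, §7.1] -/
theorem exists_unit_eq_C_pow_mul_mul {g L A B : IwasawaAlgebra p} (hg : g ≠ 0) (hL : L ≠ 0)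
    (hB : B ≠ 0) (hlamB : lam B = 0) (h : A * g = B * L) (hlam : lam L ≤ lam g) (hmu : mu L ≤ mu g) :
    ∃ u : (IwasawaAlgebra p)ˣ, g = PowerSeries.C ((p : ℤ_[p]) ^ (mu g - mu L)) * u * L := by
  have hBL : B * L ≠ 0 := mul_ne_zero hB hL
  have hA : A ≠ 0 := by
    rintro rfl
    rw [zero_mul] at h
    exact hBL h.symm
  have hlamA : lam A = 0 := by
    have e := congrArg lam h
    rw [lam_mul hA hg, lam_mul hB hL, hlamB, zero_add] at e
    omega
  have hmuAB : mu A + mu g = mu B + mu L := by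
    have e := congrArg mu h
    rwa [mu_mul hA hg, mu_mul hB hL] at e
  obtain ⟨uA, huA⟩ := exists_unit_eq_C_pow_mu_mul hA hlamA
  obtain ⟨uB, huB⟩ := exists_unit_eq_C_pow_mu_mul hB hlamB
  obtain ⟨d, hd⟩ := Nat.exists_eq_add_of_le (show mu A ≤ mu B by omega)
  have hd' : mu g - mu L = d := by omega
  have e1 : PowerSeries.C ((p : ℤ_[p]) ^ mu A) * ((uA : IwasawaAlgebra p) * g) = A * g := by
    rw [← mul_assoc, ← huA]
  have e2 : B * L = PowerSeries.C ((p : ℤ_[p]) ^ mu A) *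
      (PowerSeries.C ((p : ℤ_[p]) ^ d) * (uB : IwasawaAlgebra p) * L) := by
    rw [huB, hd, pow_add, map_mul]; ring
  have key : PowerSeries.C ((p : ℤ_[p]) ^ mu A) * ((uA : IwasawaAlgebra p) * g) =
      PowerSeries.C ((p : ℤ_[p]) ^ mu A) *
        (PowerSeries.C ((p : ℤ_[p]) ^ d) * (uB : IwasawaAlgebra p) * L) :=
    e1.trans (h.trans e2)
  have key' := mul_left_cancel₀ (C_pow_ne_zero (mu A)) key
  refine ⟨uA⁻¹ * uB, ?_⟩
  rw [hd', Units.val_mul]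
  calc g = ((uA⁻¹ : (IwasawaAlgebra p)ˣ) : IwasawaAlgebra p) * ((uA : IwasawaAlgebra p) * g) := by
        rw [← mul_assoc, Units.inv_mul, one_mul]
    _ = ((uA⁻¹ : (IwasawaAlgebra p)ˣ) : IwasawaAlgebra p) *
          (PowerSeries.C ((p : ℤ_[p]) ^ d) * (uB : IwasawaAlgebra p) * L) := by rw [key']
    _ = PowerSeries.C ((p : ℤ_[p]) ^ d) *
          (((uA⁻¹ : (IwasawaAlgebra p)ˣ) : IwasawaAlgebra p) * (uB : IwasawaAlgebra p)) * L := by ring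

/-- **`L ∣ g` ⟺ `λ(L) ≤ λ(g) ∧ μ(L) ≤ μ(g)`**, for nonzero `g, L` with a rational divisibility `A·g = B·L`,
`B ≠ 0`, `λ(B) = 0`. [cite: GreenbergVatsal2000, p. 4 (after Thm. (1.2))] -/
theorem dvd_iff_lam_le_and_mu_le {g L A B : IwasawaAlgebra p} (hg : g ≠ 0) (hL : L ≠ 0)
    (hB : B ≠ 0) (hlamB : lam B = 0) (h : A * g = B * L) :
    L ∣ g ↔ lam L ≤ lam g ∧ mu L ≤ mu g := by
  constructor
  · rintro ⟨c, hc⟩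
    exact lam_le_and_mu_le_of_eq_mul hg (by rw [hc, mul_comm])
  · rintro ⟨hlam, hmu⟩
    obtain ⟨u, hu⟩ := exists_unit_eq_C_pow_mul_mul hg hL hB hlamB h hlam hmu
    exact ⟨PowerSeries.C ((p : ℤ_[p]) ^ (mu g - mu L)) * u, hu.trans (by ring)⟩

/-- `λ` of a nonzero constant `pⁿ·d` (`d` a nonzero natural number) vanishes. [folklore] -/
theorem lam_C_pow_mul_C_natCast (n : ℕ) {d : ℕ} (hd : d ≠ 0) :
    lam (PowerSeries.C ((p : ℤ_[p]) ^ n) * PowerSeries.C (d : ℤ_[p]) : IwasawaAlgebra p) = 0 := by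
  have hpn : ((p : ℤ_[p]) ^ n) ≠ 0 :=
    pow_ne_zero n (by exact_mod_cast (Fact.out : p.Prime).ne_zero)
  have hdZ : (d : ℤ_[p]) ≠ 0 := by exact_mod_cast hd
  rw [← map_mul]
  exact LambdaConstPinch.lam_C (mul_ne_zero hpn hdZ)

/-- A nonzero constant `pⁿ·d` of `Λ` (`d ≠ 0`) is nonzero. [folklore] -/
theorem C_pow_mul_C_natCast_ne_zero (n : ℕ) {d : ℕ} (hd : d ≠ 0) :
    (PowerSeries.C ((p : ℤ_[p]) ^ n) * PowerSeries.C (d : ℤ_[p]) : IwasawaAlgebra p) ≠ 0 := by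
  refine mul_ne_zero (C_pow_ne_zero n) ?_
  rw [Ne, ← map_zero (PowerSeries.C (R := ℤ_[p])), PowerSeries.C_injective.eq_iff]
  exact_mod_cast hd

end Algebra

/-! ## §2 At `p = 2`: the Eisenstein half at a cyclotomic datum ⟺ `λ(L₀) ≤ λ(X) ∧ μ(L₀) ≤ μ(X)` -/

section Curve

open Summit.BirchSwinnertonDyer.Rank1Residual Summit.BirchSwinnertonDyer.Rank1Residual.X5

variable (W : WeierstrassCurve ℚ) [W.IsElliptic] [W.IsGloballyMinimal]

/-- **Structure of a generator of `char_Λ X(E/ℚ_∞)` at `2` from Kato 17.4 (1)(2) and the two lower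
bounds.** `E = W` good ordinary at `2`, `f` a newform of `E` (any level), `κ, γ` the cyclotomic
`ℤ₂`-extension with matching generator, `D` a dual datum with `char_Λ X = (f_X)`, `ϖ ∈ ℚ` and
`L₀ ∈ Λ` nonzero with `ι L₀ = ϖ·L₂(f,α)`; Kato 17.4 (1)(2) AT `2` (`h17`, PUBLISHED: `X` torsion and
`2ⁿ·L₂ = ι g`, `g ∈ char X`). If `λ(L₀) ≤ λ(X)` and `μ(L₀) ≤ μ(X)` then
`f_X = 2^{μ(X)−μ(L₀)}·u·L₀` with `u ∈ Λˣ`. (`λ(f_X) = λ(X)`, `μ(f_X) = μ(X)` by the structure theorem: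
tree theorems `lam_generator_eq_lambdaInvariant`, `mu_generator_eq_muInvariant`.)
[cite: Kato2004Asterisque, Thm. 17.4 (1)(2) (p. 273)] [cite: GreenbergVatsal2000, p. 4 (after Thm. (1.2))] -/
theorem exists_unit_charGen_eq_of_kato {N : ℕ} [NeZero N] {f : CuspForm (Gamma0 N) 2}
    (h17 : kato_divisibility_allPrimes W 2 (f := f))
    {κ : ZpExtension ℚ 2} {γ : Field.absoluteGaloisGroup ℚ}
    (hκ : κ.IsCyclotomic) (hγ : κ.IsTopGenerator γ) (hγ' : IsCyclotomicVariable 2 γ)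
    (hord : IsOrdinaryAt W 2) (hf : IsNewformOf W f) (D : W.SelmerDualData κ γ)
    {fX : IwasawaAlgebra 2} (hchar : D.charIdeal = Ideal.span {fX})
    {ϖ : ℚ} {L₀ : IwasawaAlgebra 2} (hL₀0 : L₀ ≠ 0)
    (hL₀ : iwasawaToPowerSeries 2 L₀ =
      PowerSeries.C (ϖ : ℚ_[2]) * padicLFunction f (unitRoot W 2 : ℚ_[2]))
    (hlam : lam L₀ ≤ D.lambda) (hmu : mu L₀ ≤ D.mu) :
    ∃ u : (IwasawaAlgebra 2)ˣ,
      fX = PowerSeries.C (((2 : ℕ) : ℤ_[2]) ^ (D.mu - mu L₀)) * u * L₀ := by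
  haveI : Module.Finite (IwasawaAlgebra 2) D.X := D.module_finite_holds hγ
  obtain ⟨hD, a, n, hkey⟩ :=
    O1.MuZeroUpgrade.exists_mul_charGen_eq_of_kato_allPrimes W 2 h17 hκ hγ hγ' hord hf D hchar hL₀
  have hfX0 : fX ≠ 0 := by
    intro h0
    refine Module.charIdeal_ne_bot (IwasawaAlgebra 2) D.X ?_
    change D.charIdeal = ⊥
    rw [hchar, h0]
    exact Ideal.span_singleton_eq_bot.mpr rfl
  have hlamfX : lam fX = D.lambda := lam_generator_eq_lambdaInvariant D.X hD hfX0 hchar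
  have hmufX : mu fX = D.mu := mu_generator_eq_muInvariant D.X hD hfX0 hchar
  have hkey' : (PowerSeries.C (ϖ.num : ℤ_[2]) * a) * fX =
      (PowerSeries.C (((2 : ℕ) : ℤ_[2]) ^ n) * PowerSeries.C (ϖ.den : ℤ_[2])) * L₀ := by
    rw [hkey, mul_assoc]
  obtain ⟨u, hu⟩ := exists_unit_eq_C_pow_mul_mul hfX0 hL₀0 (C_pow_mul_C_natCast_ne_zero n ϖ.den_nz)
    (lam_C_pow_mul_C_natCast n ϖ.den_nz) hkey' (by rw [hlamfX]; exact hlam) (by rw [hmufX]; exact hmu)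
  exact ⟨u, by rw [← hmufX]; exact hu⟩

/-- **`char_Λ X = (2^{μ(X)−μ(L₀)}·L₀)`** under the hypotheses of `exists_unit_charGen_eq_of_kato`: on a
datum where both lower bounds hold, Mazur's main conjecture at `2` is EXACTLY the inequality
`μ(X) ≤ μ(L₀)` (the Kato–Néron half, sibling crux `OrdKatoHalfAtTwo`).
[cite: Kato2004Asterisque, Thm. 17.4 (1)(2) (p. 273)] [cite: GreenbergVatsal2000, p. 4] -/
theorem charIdeal_eq_span_C_pow_mul {N : ℕ} [NeZero N] {f : CuspForm (Gamma0 N) 2}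
    (h17 : kato_divisibility_allPrimes W 2 (f := f))
    {κ : ZpExtension ℚ 2} {γ : Field.absoluteGaloisGroup ℚ}
    (hκ : κ.IsCyclotomic) (hγ : κ.IsTopGenerator γ) (hγ' : IsCyclotomicVariable 2 γ)
    (hord : IsOrdinaryAt W 2) (hf : IsNewformOf W f) (D : W.SelmerDualData κ γ)
    {ϖ : ℚ} {L₀ : IwasawaAlgebra 2} (hL₀0 : L₀ ≠ 0)
    (hL₀ : iwasawaToPowerSeries 2 L₀ =
      PowerSeries.C (ϖ : ℚ_[2]) * padicLFunction f (unitRoot W 2 : ℚ_[2]))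
    (hlam : lam L₀ ≤ D.lambda) (hmu : mu L₀ ≤ D.mu) :
    D.charIdeal = Ideal.span {PowerSeries.C (((2 : ℕ) : ℤ_[2]) ^ (D.mu - mu L₀)) * L₀} := by
  haveI : (Module.charIdeal (IwasawaAlgebra 2) D.X).IsPrincipal := charIdeal_isPrincipal_holds 2 D.X
  obtain ⟨fX, hfX⟩ := Submodule.IsPrincipal.principal (Module.charIdeal (IwasawaAlgebra 2) D.X)
  have hchar : D.charIdeal = Ideal.span {fX} := hfX
  obtain ⟨u, hu⟩ := exists_unit_charGen_eq_of_kato W h17 hκ hγ hγ' hord hf D hchar hL₀0 hL₀ hlam hmu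
  rw [hchar, hu, mul_assoc, mul_comm (u : IwasawaAlgebra 2) L₀, ← mul_assoc]
  exact Ideal.span_singleton_eq_span_singleton.mpr (associated_mul_unit_left _ _ u.isUnit)

/-- **The Eisenstein half at a cyclotomic datum ⟺ the two lower bounds.** Same data; for the
generator `f_X` of `char_Λ X`: (`∃ h ∈ Λ, ι f_X = ι h · ϖ·L₂(f,α)`) `↔ λ(L₀) ≤ λ(X) ∧ μ(L₀) ≤ μ(X)`.
(⇒): `f_X = h·L₀` by injectivity of `ι`, and `λ`, `μ` are monotone under divisibility; (⇐):
`exists_unit_charGen_eq_of_kato`. [cite: Kato2004Asterisque, Thm. 17.4 (1)(2) (p. 273)]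
[cite: SkinnerUrban2014, Conj. 3.6.8 (p. 45) (shape of the Eisenstein inclusion; p odd in print)] -/
theorem eisensteinAtDatum_iff_lam_le_and_mu_le {N : ℕ} [NeZero N] {f : CuspForm (Gamma0 N) 2}
    (h17 : kato_divisibility_allPrimes W 2 (f := f))
    {κ : ZpExtension ℚ 2} {γ : Field.absoluteGaloisGroup ℚ}
    (hκ : κ.IsCyclotomic) (hγ : κ.IsTopGenerator γ) (hγ' : IsCyclotomicVariable 2 γ)
    (hord : IsOrdinaryAt W 2) (hf : IsNewformOf W f) (D : W.SelmerDualData κ γ)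
    {fX : IwasawaAlgebra 2} (hchar : D.charIdeal = Ideal.span {fX})
    {ϖ : ℚ} {L₀ : IwasawaAlgebra 2} (hL₀0 : L₀ ≠ 0)
    (hL₀ : iwasawaToPowerSeries 2 L₀ =
      PowerSeries.C (ϖ : ℚ_[2]) * padicLFunction f (unitRoot W 2 : ℚ_[2])) :
    (∃ h : IwasawaAlgebra 2, iwasawaToPowerSeries 2 fX =
        iwasawaToPowerSeries 2 h * (PowerSeries.C (ϖ : ℚ_[2]) * padicLFunction f (unitRoot W 2 : ℚ_[2])))
      ↔ lam L₀ ≤ D.lambda ∧ mu L₀ ≤ D.mu := by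
  haveI : Module.Finite (IwasawaAlgebra 2) D.X := D.module_finite_holds hγ
  have hD : D.IsTorsion := (h17 κ γ hκ hγ hγ' hord hf D).1
  have hfX0 : fX ≠ 0 := by
    intro h0
    refine Module.charIdeal_ne_bot (IwasawaAlgebra 2) D.X ?_
    change D.charIdeal = ⊥
    rw [hchar, h0]
    exact Ideal.span_singleton_eq_bot.mpr rfl
  have hlamfX : lam fX = D.lambda := lam_generator_eq_lambdaInvariant D.X hD hfX0 hchar
  have hmufX : mu fX = D.mu := mu_generator_eq_muInvariant D.X hD hfX0 hchar
  constructor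
  · rintro ⟨h, hh⟩
    have he : fX = h * L₀ := iwasawaToPowerSeries_injective 2 (by rw [hh, map_mul, hL₀])
    rw [← hlamfX, ← hmufX]
    exact lam_le_and_mu_le_of_eq_mul hfX0 he
  · rintro ⟨hlam, hmu⟩
    obtain ⟨u, hu⟩ := exists_unit_charGen_eq_of_kato W h17 hκ hγ hγ' hord hf D hchar hL₀0 hL₀ hlam hmu
    refine ⟨PowerSeries.C (((2 : ℕ) : ℤ_[2]) ^ (D.mu - mu L₀)) * u, ?_⟩
    rw [hu, map_mul, hL₀]

/-- **Certificate form: the Eisenstein half of the `2`-adic main conjecture from the two LOWER bounds.**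
`E = W` good ordinary at `2` whenever the guard of the target asks it; PUBLISHED input Kato 17.4 (1)(2)
AT `2` (`h17`); Néron integrality `0 ≤ ord₂ ϖ` (`hper₀`, giving `L₀ ∈ Λ`); the two analytic certificates
`AnalyticLambdaEq W 2 n` (`λ(ϖ·L₂) = n`) and `AnalyticMuLE W 2 m` (`μ(ϖ·L₂) ≤ m`); and the algebraic
LOWER bounds `n ≤ λ(X)`, `m ≤ μ(X)` for every cyclotomic datum. Then
`X5.O1.MainConjectureEisensteinDivisibilityAtTwo W`. No rank, no CM/non-CM, no image hypothesis.
[cite: Kato2004Asterisque, Thm. 17.4 (1)(2) (p. 273)] [cite: GreenbergVatsal2000, p. 4 (after Thm. (1.2))] -/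
theorem mainConjectureEisensteinDivisibilityAtTwo_of_le_lambda_of_le_mu
    (h17 : ∀ [NeZero (W.conductorNorm ℤ)] (f : CuspForm (Gamma0 (W.conductorNorm ℤ)) 2),
      kato_divisibility_allPrimes W 2 (f := f))
    (hper₀ : ∀ [NeZero (W.conductorNorm ℤ)] (f : CuspForm (Gamma0 (W.conductorNorm ℤ)) 2),
      IsNewformOf W f → ∀ ϖ : ℚ, (ϖ : ℝ) * W.realPeriodRat = plusPeriod f → 0 ≤ padicValRat 2 ϖ)
    {n m : ℕ} (hlan : AnalyticLambdaEq W 2 n) (hμan : AnalyticMuLE W 2 m)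
    (hX : ∀ (κ : ZpExtension ℚ 2) (γ : Field.absoluteGaloisGroup ℚ), κ.IsCyclotomic →
      κ.IsTopGenerator γ → IsCyclotomicVariable 2 γ → ∀ D : W.SelmerDualData κ γ,
      n ≤ D.lambda ∧ m ≤ D.mu) :
    O1.MainConjectureEisensteinDivisibilityAtTwo W := by
  intro κ γ hκ hγ hγ' hord _ f hf ϖ hϖ D fX hchar
  obtain ⟨L₀, hL₀⟩ :=
    O1.exists_integral_mul_padicLFunction_two_of_padicValRat_nonneg W hord hf (hper₀ f hf ϖ hϖ)
  obtain ⟨k, hk⟩ := hμan f hf ϖ hϖ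
  rw [← hL₀] at hk
  have hμL₀ : mu L₀ ≤ m := mu_le_of_lt_norm_coeff hk
  have hL₀0 : L₀ ≠ 0 := by
    rintro rfl
    rw [map_zero, map_zero, norm_zero] at hk
    exact not_le.mpr hk (by positivity)
  have hlamL₀ : lam L₀ = n := hlan f hf ϖ hϖ L₀ hL₀
  obtain ⟨hn, hm⟩ := hX κ γ hκ hγ hγ' D
  exact (eisensteinAtDatum_iff_lam_le_and_mu_le W (h17 f) hκ hγ hγ' hord hf D hchar hL₀0 hL₀).mpr
    ⟨by rw [hlamL₀]; exact hn, hμL₀.trans hm⟩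

/-! ## §3 `λ(X) ≥ n` from Mordell–Weil rank `≥ n` in a layer of the `ℤ₂`-tower (Greenberg Thm. 1.9) -/

omit [W.IsGloballyMinimal] in
/-- **`n ≤ λ(X(E/ℚ_∞))` from `n ≤ rank_ℤ E(ℚ_k)`** (Greenberg, LNM 1716, Thm. 1.9 — tree THEOREM
`WeierstrassCurve.mordellWeilRank_layer_le_lambdaInvariant`, unconditional), for a torsion cyclotomic
datum at `2`; the rank input is the cell's typed certificate `Iwasawa.LayerRankGEAt W 2 k n`
(`ℚ_1 = ℚ(√2)`). [cite: GreenbergLNM1716, Thm. 1.9 (PDF p. 63)] -/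
theorem le_lambda_of_layerRankGEAt {k n : ℕ} (hr : Iwasawa.LayerRankGEAt W 2 k n)
    {κ : ZpExtension ℚ 2} {γ : Field.absoluteGaloisGroup ℚ} (hκ : κ.IsCyclotomic)
    (hγ : κ.IsTopGenerator γ) (D : W.SelmerDualData κ γ) (hD : D.IsTorsion) : n ≤ D.lambda := by
  haveI : Module.Finite (IwasawaAlgebra 2) D.X := D.module_finite_holds hγ
  exact (hr κ hκ).trans (W.mordellWeilRank_layer_le_lambdaInvariant hγ D hD k)

/-- **The Eisenstein half of the `2`-adic main conjecture on the RANK-GROWTH locus.** `E = W` good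
ordinary at `2` (guard of the target); Kato 17.4 (1)(2) AT `2` (`h17`, PUBLISHED); certificates: Néron
integrality `hper₀`, `AnalyticLambdaEq W 2 n`, `AnalyticMuLE W 2 0` (analytic `μ = 0`), and
`Iwasawa.LayerRankGEAt W 2 k n` — `λ_an(E) ≤ rank_ℤ E(ℚ_k)` at some layer `ℚ_k` of the cyclotomic
`ℤ₂`-tower (`ℚ_1 = ℚ(√2)`: `rank E(ℚ) + rank E^{(2)}(ℚ)`). Then
`X5.O1.MainConjectureEisensteinDivisibilityAtTwo W`: Greenberg Thm. 1.9 turns the rank into `λ(X) ≥ n`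
(§3), `μ(X) ≥ 0` is free, and §2 concludes. [cite: GreenbergLNM1716, Thm. 1.9 (PDF p. 63)]
[cite: Kato2004Asterisque, Thm. 17.4 (1)(2) (p. 273)] -/
theorem mainConjectureEisensteinDivisibilityAtTwo_of_layerRankGEAt
    (h17 : ∀ [NeZero (W.conductorNorm ℤ)] (f : CuspForm (Gamma0 (W.conductorNorm ℤ)) 2),
      kato_divisibility_allPrimes W 2 (f := f))
    (hper₀ : ∀ [NeZero (W.conductorNorm ℤ)] (f : CuspForm (Gamma0 (W.conductorNorm ℤ)) 2),
      IsNewformOf W f → ∀ ϖ : ℚ, (ϖ : ℝ) * W.realPeriodRat = plusPeriod f → 0 ≤ padicValRat 2 ϖ)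
    {n k : ℕ} (hlan : AnalyticLambdaEq W 2 n) (hμan : AnalyticMuLE W 2 0)
    (hr : Iwasawa.LayerRankGEAt W 2 k n) :
    O1.MainConjectureEisensteinDivisibilityAtTwo W := by
  intro κ γ hκ hγ hγ' hord _ f hf ϖ hϖ D fX hchar
  exact mainConjectureEisensteinDivisibilityAtTwo_of_le_lambda_of_le_mu W h17 hper₀ hlan hμan
    (fun κ₁ γ₁ hκ₁ hγ₁ hγ₁' D₁ =>
      ⟨le_lambda_of_layerRankGEAt W hr hκ₁ hγ₁ D₁ (h17 f κ₁ γ₁ hκ₁ hγ₁ hγ₁' hord hf D₁).1,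
        Nat.zero_le _⟩)
    κ γ hκ hγ hγ' hord f hf ϖ hϖ D fX hchar

end Curve

/-! ## §4 The ∀-closed form: the crux constant from the displayed PUB input + per-curve certificates -/

/-- **`OrdEisensteinHalfAtTwo` on the rank-growth locus, ∀-closed.** If every non-CM curve good ordinary
at `2` carried (i) Kato 17.4 (1)(2) AT `2` (PUBLISHED — the third conjunct of the support item
`OrdPublishedInputsAtTwo`), (ii) Néron integrality, and (iii) the certificates `AnalyticLambdaEq W 2 n`,
`AnalyticMuLE W 2 0`, `Iwasawa.LayerRankGEAt W 2 k n` for some `n, k`, then the crux constant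
`Theorems.OrdHalvesAtTwo.OrdEisensteinHalfAtTwo` (= the route decls
`Theses.ByReductionTypeAtTwo.OrdEisensteinHalfAtTwo` / `Theses.TwoAdicConverse.OrdEisensteinHalfAtTwo`)
holds. A REDUCTION, not a closing: hypothesis (iii) is a per-curve certificate schema that holds only
on the sub-locus where `λ_an(E)` is Mordell–Weil growth in the `2`-tower; class-wide it is NOT claimed
(module docstring, HONEST SCOPE). [cite: GreenbergLNM1716, Thm. 1.9 (PDF p. 63)]
[cite: Kato2004Asterisque, Thm. 17.4 (1)(2) (p. 273)] -/
theorem ordEisensteinHalfAtTwo_of_layerRankGEAt_certificates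
    (h17 : ∀ (W : WeierstrassCurve ℚ) [W.IsElliptic] [W.IsGloballyMinimal]
      [NeZero (W.conductorNorm ℤ)] (f : CuspForm (Gamma0 (W.conductorNorm ℤ)) 2),
      kato_divisibility_allPrimes W 2 (f := f))
    (hcert : ∀ (W : WeierstrassCurve ℚ) [W.IsElliptic] [W.IsGloballyMinimal], ¬ W.HasCM →
      GoodOrd W 2 →
      (∀ [NeZero (W.conductorNorm ℤ)] (f : CuspForm (Gamma0 (W.conductorNorm ℤ)) 2),
        IsNewformOf W f → ∀ ϖ : ℚ, (ϖ : ℝ) * W.realPeriodRat = plusPeriod f → 0 ≤ padicValRat 2 ϖ) ∧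
      ∃ n k : ℕ, AnalyticLambdaEq W 2 n ∧ AnalyticMuLE W 2 0 ∧
        Summit.BirchSwinnertonDyer.Rank1Residual.Iwasawa.LayerRankGEAt W 2 k n) :
    Summit.BirchSwinnertonDyer.BirchSwinnertonDyer.Theorems.OrdHalvesAtTwo.OrdEisensteinHalfAtTwo := by
  intro W _ _ hcm hgo
  obtain ⟨hper₀, n, k, hlan, hμan, hr⟩ := hcert W hcm hgo
  exact mainConjectureEisensteinDivisibilityAtTwo_of_layerRankGEAt W (h17 W) hper₀ hlan hμan hr

end Summit.BirchSwinnertonDyer.BirchSwinnertonDyer.Theorems.EisensteinLowerBounds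

end
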